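import Mathlib
import HarnessLib
import Summits.ValiantsHypothesis.ValiantsHypothesis.Theses.MonotoneRestoration
import Literature.Computability.AlgebraicComplexity.ArithCircuit
import Literature.Computability.AlgebraicComplexity.ArithCircuitProofs
import Literature.Computability.AlgebraicComplexity.MonotoneStructure
import Literature.Computability.AlgebraicComplexity.PermanentIrreducible
import Literature.ModelTheory.FiniteModelTheory.CkEquiv
import Summits.ValiantsHypothesis.ValiantsHypothesis.Theorems.MonotoneRestorationMonotoneRestorationQPCosetCount
import Summits.ValiantsHypothesis.ValiantsHypothesis.Theorems.MonotoneRestorationMonotoneRestorationQPSymmetricLB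
import Summits.ValiantsHypothesis.ValiantsHypothesis.Theorems.MonotoneRestorationMonotoneRestorationQPSupportSymmetrisation
import Summits.ValiantsHypothesis.ValiantsHypothesis.Theorems.MonotoneRestorationMonotoneRestorationQPSparseRegime
import Summits.ValiantsHypothesis.ValiantsHypothesis.Theorems.MonotoneRestorationMonotoneRestorationQPBeta
import Literature.Computability.AlgebraicComplexity.SymmetricArithCircuit
import Literature.Computability.AlgebraicComplexity.DawarWilsenach2025Proofs
import Literature.GroupTheory.PermutationGroups.SmallIndexSubgroups
import Summits.ValiantsHypothesis.ValiantsHypothesis.Theorems.MonotoneRestorationQP.Negative.LoadBearing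
import Summits.ValiantsHypothesis.ValiantsHypothesis.Theorems.MonotoneRestorationMonotoneRestorationQPPermSupportCount

/-! TTRL-lite variant V20076 of stmt-ValiantsHypothesis-15886 -/

-- `Summit.ValiantsHypothesis.ValiantsHypothesis.…` is the tree's mandated single-conjunct layout
-- (Sub = Summit), so the duplicated namespace component is intended.
set_option linter.dupNamespace false

namespace Summit.ValiantsHypothesis.ValiantsHypothesis.Theorems

open Summit.ValiantsHypothesis.ValiantsHypothesis.Theses.MonotoneRestoration
open Literature.Computability.AlgebraicComplexity

/-- **TTRL-lite variant V20076** (`lemma_proposal`, have-step `gamma_rename_eval_eq` at an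
arbitrary gate type `G : Type`) of `stub_symmetricMonotone_choose_le_card`
(crux item `stmt-ValiantsHypothesis-15886`): in a labelled arithmetic circuit over `ℝ≥0` on the
`n × n` matrix of variables (diagonal `Sym_n`-action), a gate `g` fixed by a circuit automorphism
`π` extending `ρ` computes a polynomial invariant under the diagonal renaming
`x_{ij} ↦ x_{ρ i, ρ j}`. Proof: automorphisms act on gate values by renaming
(`IsAutomorphismExtending.eval_apply`), and the product action of `ρ` on `Fin n × Fin n` is
definitionally `p ↦ (ρ p.1, ρ p.2)`. [cite: DawarWilsenach2025, §3.2 (after Def. 3.7)] -/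
theorem stub_symmetricMonotone_choose_le_card_var20076 : ∀ (n : ℕ) (G : Type) (C : LabelledArithCircuit NNReal (Fin n × Fin n) Unit G) (ρ : Equiv.Perm (Fin n)) (π : Equiv.Perm G) (g : G), C.IsAutomorphismExtending ρ π → π g = g → MvPolynomial.rename (fun p : Fin n × Fin n => (ρ p.1, ρ p.2)) (C.eval g) = C.eval g := by
  intro n G C ρ π g hπ hg
  have h := hπ.eval_apply g
  rw [hg] at h
  exact h.symm

end Summit.ValiantsHypothesis.ValiantsHypothesis.Theorems
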